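import Literature.Probability.RandomPlanarGeometry.CritPercSLESpaceFilling
import Literature.Probability.RandomPlanarGeometry.LoewnerFlow
import Literature.Probability.RandomPlanarGeometry.RestrictionHullsProofs
import HarnessLib

/-!
# Density of the SLE_κ trace for `κ ≥ 8`: reduction to Rohde–Schramm's Lemma 6.3

This file performs the second layer of the decomposition of the space-filling phase
`Literature.Probability.RandomPlanarGeometry.ae_isSpaceFilling_sleTrace_of_eight_le` (**crit-perc.S20**; Rohde–Schramm, Ann.
Math. 161 (2005), Cor. 7.4 and its Update, p. 911). The first layer
(`CritPercSLESpaceFilling.lean`) reduced it to trace existence, transience and the per-point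
density fact `Literature.Probability.RandomPlanarGeometry.ae_infDist_sleTrace_eq_zero_of_eight_le` ("Lemma 6.3 with eq. (6.2)"). Here
that density fact is in turn PROVED from

* the probabilistic core, vendored as the named fact
  `Literature.Probability.RandomPlanarGeometry.tendsto_sleDerivRatio_atTop_of_eight_le` — **Rohde–Schramm (2005), Lemma 6.3**, case
  `κ ≥ 8` (p. 903): for `z₀ ∈ ℍ`, almost surely
  `Z(z₀) = lim_{t ↑ τ(z₀)} (Im z₀) |gₜ'(z₀)| / Im gₜ(z₀) = ∞`;
* the existence of the trace (`Literature.Probability.RandomPlanarGeometry.hasSLETrace_eight`, `Literature.Probability.RandomPlanarGeometry.hasSLETrace_of_ne_eight`);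

and the deterministic half of the argument, which is proved here:

* **eq. (6.2), first inequality** (p. 903: "the Schwarz lemma applied to the map
  `z ↦ φ(gₜ(z₀ + rₜ z))` proves `rₜ |gₜ'(z₀)| ≤ 2 Im gₜ(z₀)`", `rₜ = dist(z₀, ∂Hₜ)`):
  `Literature.Probability.RandomPlanarGeometry.Loewner.infDist_compl_domain_mul_norm_deriv_map_le`, from the tree's Schwarz–Pick bound
  for holomorphic maps of a disc into `ℍ` (`Literature.Probability.RandomPlanarGeometry.HalfPlanePick.norm_deriv_le_two_mul_im_div`,
  `RestrictionHullsProofs.lean`: `|f'(c)| ≤ 2 Im f(c) / R`) applied to the Loewner map `gₜ`,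
  which is holomorphic on the open set `Hₜ ⊇ B(z₀, rₜ)` with values in `ℍ`
  (`Loewner.differentiableOn_map`, `Loewner.isOpen_domain`, `Loewner.mapsTo_map`, all proved in
  the tree);
* **the topology** `dist(z₀, γ[0, t] ∪ ℝ) ≤ dist(z₀, ∂Hₜ) = dist(z₀, Hₜᶜ)` for a chain
  generated by `γ` and `z₀ ∈ Hₜ` (`Literature.Probability.RandomPlanarGeometry.Loewner.IsGeneratedByCurve.ball_subset_domain`,
  `…infDist_le_infDist_compl_domain`): the disc about `z₀` of radius `dist(z₀, γ[0,t] ∪ ℝ)`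
  is a connected subset of `ℍ ∖ γ[0, t]` containing `z₀`, hence lies in the unbounded
  component `Hₜ` (`Hₜ` *is* that component for a chain generated by `γ`; cf.
  `Loewner.IsGeneratedByCurve.domain_eq` in `LoewnerTraceLimit.lean`, re-derived inline here to
  keep the import closure small).

Assembly: `Literature.Probability.RandomPlanarGeometry.ae_infDist_sleTrace_eq_zero_of_eight_le_of_facts` (for a.e. `ω`, for every
`t < τ(z₀)`: `dist(z₀, γ[0, ∞) ∪ ℝ) ≤ rₜ ≤ 2 Im gₜ(z₀) / |gₜ'(z₀)| = 2 (Im z₀) / Zₜ → 0`), and the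
end-to-end reduction of the space-filling phase to the four core theorems
`Literature.Probability.RandomPlanarGeometry.ae_isSpaceFilling_sleTrace_of_eight_le_of_core_facts`
(LSW04 Thm 4.7, RS05 Thm 5.1, RS05 Thm 7.1, RS05 Lemma 6.3).

## Mathlib

We USE `Metric.ball_infDist_compl_subset`, `Metric.infDist_lt_iff`, `Convex.isPreconnected`,
`IsPreconnected.subset_connectedComponentIn`, `connectedComponentIn_eq`,
`Filter.Tendsto.eventually_ge_atTop`, and (via `HalfPlanePick.norm_deriv_le_two_mul_im_div`)
the Schwarz lemma `Complex.norm_deriv_le_div_of_mapsTo_ball`. Mathlib has no Loewner chains /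
SLE; the Koebe 1/4 theorem (second inequality of (6.2)) is not needed here.

## References

* S. Rohde, O. Schramm, *Basic properties of SLE*, Ann. of Math. 161 (2005) 883–924:
  Lemma 6.3 and eq. (6.2), (6.3) (pp. 903–904); Cor. 7.4 and Update (p. 911).
* G. F. Lawler, *Conformally Invariant Processes in the Plane*, AMS (2005), Ch. 4 §4.1
  (the maps `gₜ : Hₜ → ℍ`).
-/

noncomputable section

open Set Filter Topology MeasureTheory Metric Bornology Complex
open UpperHalfPlane (upperHalfPlaneSet isOpen_upperHalfPlaneSet)
open scoped NNReal ComplexConjugate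

namespace Literature.Probability.RandomPlanarGeometry

/-! ### Rohde–Schramm's derivative ratio and Lemma 6.3 (`κ ≥ 8`) -/

/-- **Rohde–Schramm's ratio `(Im z₀) |gₜ'(z₀)| / Im gₜ(z₀)`** before the limit `t ↑ τ(z₀)`
(Rohde–Schramm, Ann. Math. 161 (2005), Lemma 6.3, p. 903: `Z(z) := lim_{t↑τ(z)} y |gₜ'(z)| /
Im gₜ(z)`, `z = x + iy`), for the SLE_κ Loewner map `gₜ = sleMap κ ω t` and its complex
derivative `gₜ' = deriv (sleMap κ ω t)` at `z`. Meaningful for `t < τ(z)` (then `z ∈ Hₜ`, an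
open set on which `gₜ` is holomorphic with values in `ℍ`); junk afterwards (never used). By
(6.3) it is non-decreasing in `t` and at least `1`. [cite: RohdeSchramm2005, Lemma 6.3] -/
def sleDerivRatio (κ : ℝ≥0) (ω : ℝ≥0 → ℝ) (z : ℂ) (t : ℝ≥0) : ℝ :=
  z.im * ‖deriv (sleMap κ ω t) z‖ / (sleMap κ ω t z).im

/-- Unfolding lemma for `sleDerivRatio`. [folklore] -/
theorem sleDerivRatio_apply (κ : ℝ≥0) (ω : ℝ≥0 → ℝ) (z : ℂ) (t : ℝ≥0) :
    sleDerivRatio κ ω z t = z.im * ‖deriv (sleMap κ ω t) z‖ / (sleMap κ ω t z).im := rfl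

/-- At time `0` the ratio is `1` for every `z ∈ ℍ` (`g₀ = id` near `z`, `Loewner.map_zero_apply`):
the normalisation `Z ≥ 1` of Rohde–Schramm (2005), proof of Lemma 6.3 ("`1 ≤ ŷ |g_T'(ẑ)| / y_T`",
p. 905) at its starting point. [cite: RohdeSchramm2005, Lemma 6.3] -/
theorem sleDerivRatio_zero (κ : ℝ≥0) (ω : ℝ≥0 → ℝ) {z : ℂ} (hz : z ∈ upperHalfPlaneSet) :
    sleDerivRatio κ ω z 0 = 1 := by
  have hW : Continuous (sleDriving κ ω) := continuous_sleDriving κ ω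
  have hzim : 0 < z.im := hz
  have hzW : z ≠ (sleDriving κ ω 0 : ℂ) := by
    intro h
    have : z.im = 0 := by rw [h, Complex.ofReal_im]
    rw [this] at hzim
    exact lt_irrefl _ hzim
  have hne : ∀ᶠ w in 𝓝 z, w ≠ (sleDriving κ ω 0 : ℂ) := isOpen_ne.mem_nhds hzW
  have heq : sleMap κ ω 0 =ᶠ[𝓝 z] id :=
    hne.mono fun w hw ↦ Loewner.map_zero_apply hW hw
  rw [sleDerivRatio_apply, heq.deriv_eq, deriv_id, norm_one, mul_one,
    show sleMap κ ω 0 z = z from Loewner.map_zero_apply hW hzW, div_self hzim.ne']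

/-- **Rohde–Schramm (2005), Lemma 6.3, the case `κ ≥ 8`** (p. 903). "Let `κ > 0` and
`z = x + iy ∈ ℍ`. Then the limit `Z(z) := lim_{t ↑ τ(z)} y |gₜ'(z)| / Im(gₜ(z))` exists a.s.
We have `Z(z) = ∞` a.s. if `κ ≥ 8` and `Z(z) < ∞` a.s. if `κ < 8`." Vendored: for `κ ≥ 8` and
`z ∈ ℍ`, almost surely `sleDerivRatio κ ω z t → ∞` as `t` increases to the swallowing time
`τ(z) = Loewner.swallowingTime (sleDriving κ ω) z` through `[0, τ(z))` (the filter `atTop` of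
the time interval `{t | ↑t < τ(z)}`, which is nonempty as `τ(z) > 0`; `τ(z) = ⊤` allowed).
The printed proof: (6.3) `Z = exp ∫₀^τ 4 yₜ² |zₜ|⁻⁴ dt`, the local martingale
`Mₜ = (ŷ |gₜ'(ẑ)| / yₜ)^a Ĝ(zₜ)` with `Ĝ` hypergeometric, optional sampling, and
`Ĝ_{1-κ/8,κ}(1) = ∞` for `κ > 8` (resp. the coefficient estimate for `κ = 8`).
[cite: RohdeSchramm2005, Lemma 6.3] -/
def tendsto_sleDerivRatio_atTop_of_eight_le : Prop :=
  ∀ {κ : ℝ≥0}, 8 ≤ κ → ∀ z ∈ upperHalfPlaneSet, ∀ᵐ ω ∂Process.preWienerMeasure,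
    Tendsto
      (fun t : {t : ℝ≥0 // (t : WithTop ℝ≥0) < Loewner.swallowingTime (sleDriving κ ω) z} ↦
        sleDerivRatio κ ω z t)
      atTop atTop

/-! ### Eq. (6.2), first inequality: the Schwarz-lemma bound -/

namespace Loewner

variable {W : ℝ≥0 → ℝ} {γ : ℝ≥0 → ℂ}

/-- **Eq. (6.2), first inequality, for the Loewner map** (Rohde–Schramm (2005), p. 903: "the
Schwarz lemma applied to the map `z ↦ φ(gₜ(z₀ + rₜ z))` proves `rₜ |gₜ'(z₀)| ≤ 2 Im gₜ(z₀)`",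
`φ` a conformal map of `ℍ` onto `𝔻`): for a continuous driving function, `z ∈ Hₜ` and
`rₜ = dist(z, ∂Hₜ) = dist(z, Hₜᶜ)`, `rₜ |gₜ'(z)| ≤ 2 Im gₜ(z)` — the disc `B(z, rₜ)` lies in the
open set `Hₜ` (`Metric.ball_infDist_compl_subset`), on which `gₜ` is holomorphic with values in
`ℍ` (`differentiableOn_map`, `mapsTo_map`), so the Schwarz–Pick bound
`HalfPlanePick.norm_deriv_le_two_mul_im_div` applies. [cite: RohdeSchramm2005, eq. (6.2)] -/
theorem infDist_compl_domain_mul_norm_deriv_map_le (hW : Continuous W) {t : ℝ≥0} {z : ℂ}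
    (hz : z ∈ domain W t) :
    infDist z (domain W t)ᶜ * ‖deriv (map W t) z‖ ≤ 2 * (map W t z).im := by
  have him : 0 < (map W t z).im := mapsTo_map hW t hz
  rcases (infDist_nonneg (x := z) (s := (domain W t)ᶜ)).eq_or_lt with h0 | hpos
  · rw [← h0, zero_mul]
    positivity
  · have h := HalfPlanePick.norm_deriv_le_two_mul_im_div hpos
      ((differentiableOn_map hW t).mono ball_infDist_compl_subset)
      ((mapsTo_map hW t).mono_left ball_infDist_compl_subset)
    rw [le_div_iff₀ hpos] at h
    linarith

/-! ### Topology: the disc of radius `dist(z, γ[0,t] ∪ ℝ)` about `z ∈ Hₜ` lies in `Hₜ` -/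

/-- **The disc about `z ∈ Hₜ` of radius `dist(z, γ[0, t] ∪ ℝ)` lies in `Hₜ`** (chain generated
by `γ`): the disc is a connected subset of `ℍ ∖ γ[0, t]` containing `z`, so it lies in the
connected component of `z`, which is unbounded. This is the identification
`rₜ = dist(z₀, ∂Hₜ) ≥ dist(z₀, γ[0, t] ∪ ℝ)` implicit in Rohde–Schramm (2005), after eq. (6.2)
("since `lim_{t↑τ(z₀)} rₜ = dist(z₀, γ[0, ∞) ∪ ℝ)`"). [cite: RohdeSchramm2005, eq. (6.2)] -/
theorem IsGeneratedByCurve.ball_subset_domain (h : IsGeneratedByCurve W γ) {t : ℝ≥0} {z : ℂ}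
    (hz : z ∈ domain W t) :
    ball z (infDist z (γ '' Icc 0 t ∪ {w : ℂ | w.im = 0})) ⊆ domain W t := by
  set S : Set ℂ := γ '' Icc 0 t ∪ {w : ℂ | w.im = 0} with hS_def
  set d : ℝ := infDist z S with hd_def
  set U : Set ℂ := upperHalfPlaneSet \ γ '' Icc 0 t with hU_def
  -- `Hₜ = ℍ ∖ Kₜ` *is* the union of the unbounded components of `U` (definition of "generated
  -- by a curve"; cf. `IsGeneratedByCurve.domain_eq` in `LoewnerTraceLimit.lean`)
  have hdom : domain W t = unboundedComponent U := by
    ext p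
    rw [domain, h.hull_eq t]
    exact ⟨fun ⟨hp, hnot⟩ ↦ by_contra fun hc ↦ hnot ⟨hp, hc⟩,
      fun hp ↦ ⟨(unboundedComponent_subset _ hp).1, fun hq ↦ hq.2 hp⟩⟩
  have hzim : 0 < z.im := domain_subset W t hz
  -- `d ≤ Im z`: the real point below `z` is in `S` (used by `linarith` below)
  have hd_le : d ≤ z.im := by
    have hmem : ((z.re : ℝ) : ℂ) ∈ S := Or.inr (by simp)
    calc d ≤ dist z (z.re : ℂ) := infDist_le_dist_of_mem hmem
      _ = z.im := by
        rw [dist_eq_norm, show z - (z.re : ℂ) = (z.im : ℝ) * I from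
          Complex.ext (by simp) (by simp), norm_mul, Complex.norm_I, mul_one, Complex.norm_real,
          Real.norm_eq_abs, abs_of_pos hzim]
  -- the disc lies in `U = ℍ ∖ γ[0, t]`
  have hball : ball z d ⊆ U := by
    intro p hp
    rw [mem_ball, dist_comm] at hp
    refine ⟨?_, fun hpγ ↦ ?_⟩
    · have h1 : |(z - p).im| ≤ ‖z - p‖ := abs_im_le_norm (z - p)
      rw [Complex.sub_im, ← dist_eq_norm] at h1
      have h2 := (abs_sub_lt_iff.1 (h1.trans_lt hp)).1
      show 0 < p.im
      linarith
    · have : d ≤ dist z p := infDist_le_dist_of_mem (Or.inl hpγ)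
      linarith
  rcases (infDist_nonneg (x := z) (s := S)).eq_or_lt with h0 | hdpos
  · have hd0 : d = 0 := by rw [hd_def]; exact h0.symm
    rw [hd0, ball_zero]
    exact empty_subset _
  intro p hp
  rw [hdom] at hz ⊢
  have hzball : z ∈ ball z d := mem_ball_self hdpos
  have hsub : ball z d ⊆ connectedComponentIn U z :=
    (convex_ball z d).isPreconnected.subset_connectedComponentIn hzball hball
  have heq : connectedComponentIn U z = connectedComponentIn U p := connectedComponentIn_eq (hsub hp)
  exact ⟨hball hp, heq ▸ hz.2⟩

/-- **`dist(z, γ[0, t] ∪ ℝ) ≤ dist(z, Hₜᶜ) = rₜ`** for a chain generated by `γ` and `z ∈ Hₜ`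
(from `ball_subset_domain`). Rohde–Schramm (2005), after eq. (6.2). [cite: RohdeSchramm2005, eq. (6.2)] -/
theorem IsGeneratedByCurve.infDist_le_infDist_compl_domain (h : IsGeneratedByCurve W γ)
    {t : ℝ≥0} {z : ℂ} (hz : z ∈ domain W t) :
    infDist z (γ '' Icc 0 t ∪ {w : ℂ | w.im = 0}) ≤ infDist z (domain W t)ᶜ := by
  have h0 : (0 : ℂ) ∉ domain W t := fun h0 ↦ by
    have : (0 : ℝ) < (0 : ℂ).im := domain_subset W t h0
    simp at this
  have hne : Set.Nonempty (domain W t)ᶜ := ⟨0, h0⟩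
  refine le_of_not_gt fun hlt ↦ ?_
  obtain ⟨y, hy, hyd⟩ := (infDist_lt_iff hne).1 hlt
  exact hy (h.ball_subset_domain hz (mem_ball'.2 hyd))

/-- The same bound with the whole trace: `dist(z, γ[0, ∞) ∪ ℝ) ≤ dist(z, Hₜᶜ)` for `z ∈ Hₜ`.
[cite: RohdeSchramm2005, eq. (6.2)] -/
theorem IsGeneratedByCurve.infDist_range_le_infDist_compl_domain (h : IsGeneratedByCurve W γ)
    {t : ℝ≥0} {z : ℂ} (hz : z ∈ domain W t) :
    infDist z (range γ ∪ {w : ℂ | w.im = 0}) ≤ infDist z (domain W t)ᶜ := by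
  have hsub : γ '' Icc 0 t ∪ {w : ℂ | w.im = 0} ⊆ range γ ∪ {w : ℂ | w.im = 0} :=
    union_subset_union_left _ (image_subset_range _ _)
  have hne : (γ '' Icc 0 t ∪ {w : ℂ | w.im = 0}).Nonempty :=
    ⟨γ 0, Or.inl ⟨0, ⟨le_rfl, bot_le⟩, rfl⟩⟩
  exact (infDist_le_infDist_of_subset hsub hne).trans (h.infDist_le_infDist_compl_domain hz)

end Loewner

/-! ### Assembly: per-point density from Lemma 6.3 and the existence of the trace -/

/-- **Per-point density of the SLE_κ trace, `κ ≥ 8`, from Rohde–Schramm's Lemma 6.3**: the named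
fact `ae_infDist_sleTrace_eq_zero_of_eight_le` ("Lemma 6.3 with eq. (6.2)") follows from
Lemma 6.3 proper (`tendsto_sleDerivRatio_atTop_of_eight_le`, hypothesis `hZ`) and the
existence of the trace (`hasSLETrace_eight`, LSW04 Thm 4.7, `h8`; `hasSLETrace_of_ne_eight`,
RS05 Thm 5.1, `hne`), the rest being proved: for a.e. `ω` and every `t < τ(z)`,
`dist(z, γ[0, ∞) ∪ ℝ) ≤ dist(z, Hₜᶜ) ≤ 2 Im gₜ(z) / |gₜ'(z)| = 2 (Im z) / Zₜ`, and `Zₜ → ∞`.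
Rohde–Schramm (2005), Lemma 6.3 and eq. (6.2), pp. 903–904.
[cite: RohdeSchramm2005, Lemma 6.3 and eq. (6.2)] -/
theorem ae_infDist_sleTrace_eq_zero_of_eight_le_of_facts (h8 : hasSLETrace_eight)
    (hne : hasSLETrace_of_ne_eight) (hZ : tendsto_sleDerivRatio_atTop_of_eight_le) :
    ae_infDist_sleTrace_eq_zero_of_eight_le := by
  intro κ hκ z hz
  filter_upwards [ae_isGeneratedByCurve_sleTrace (hasSLETrace h8 hne κ), hZ hκ z hz] with ω hg hT
  have hW : Continuous (sleDriving κ ω) := continuous_sleDriving κ ω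
  set S : Set ℂ := range (sleTrace κ ω) ∪ {w : ℂ | w.im = 0} with hS_def
  -- the time interval `[0, τ(z))` is nonempty
  have hzim : 0 < z.im := hz
  have hzW : z ≠ sleDriving κ ω 0 := by
    intro h
    have : z.im = 0 := by rw [h, Complex.ofReal_im]
    rw [this] at hzim
    exact lt_irrefl _ hzim
  have h0 : ((0 : ℝ≥0) : WithTop ℝ≥0) < Loewner.swallowingTime (sleDriving κ ω) z :=
    Loewner.swallowingTime_pos_holds hW hzW
  haveI : Nonempty {t : ℝ≥0 // (t : WithTop ℝ≥0) < Loewner.swallowingTime (sleDriving κ ω) z} :=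
    ⟨⟨0, h0⟩⟩
  refine le_antisymm (le_of_forall_pos_lt_add fun ε hε ↦ ?_) infDist_nonneg
  -- pick `t < τ(z)` with `Zₜ ≥ M := 2 Im z / ε + 1`
  obtain ⟨t, ht⟩ := (hT.eventually_ge_atTop (2 * z.im / ε + 1)).exists
  have hzdom : z ∈ Loewner.domain (sleDriving κ ω) t :=
    (Loewner.mem_domain_iff _ _ _).2 ⟨hz, t.2⟩
  have him : 0 < (sleMap κ ω t z).im := Loewner.mapsTo_map hW t hzdom
  -- `dist(z, S) ≤ rₜ` and `rₜ |gₜ'(z)| ≤ 2 Im gₜ(z)`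
  have h1 : infDist z S ≤ infDist z (Loewner.domain (sleDriving κ ω) t)ᶜ :=
    hg.infDist_range_le_infDist_compl_domain hzdom
  have h2 : infDist z (Loewner.domain (sleDriving κ ω) t)ᶜ * ‖deriv (sleMap κ ω t) z‖ ≤
      2 * (sleMap κ ω t z).im :=
    Loewner.infDist_compl_domain_mul_norm_deriv_map_le hW hzdom
  -- `Zₜ ≥ M` : `M Im gₜ(z) ≤ Im z |gₜ'(z)|`
  have h3 : 2 * z.im / ε + 1 ≤ z.im * ‖deriv (sleMap κ ω t) z‖ / (sleMap κ ω t z).im := ht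
  rw [le_div_iff₀ him] at h3
  have hMpos : 0 < 2 * z.im / ε + 1 := by positivity
  have hD : 0 < ‖deriv (sleMap κ ω t) z‖ := by
    refine lt_of_not_ge fun hD ↦ ?_
    have : z.im * ‖deriv (sleMap κ ω t) z‖ ≤ 0 :=
      mul_nonpos_of_nonneg_of_nonpos hzim.le hD
    nlinarith [mul_pos hMpos him]
  -- combine: `r D ≤ 2 Im g ≤ 2 Im z D / M`, so `r ≤ 2 Im z / M < ε`
  set r := infDist z (Loewner.domain (sleDriving κ ω) t)ᶜ with hr_def
  set D := ‖deriv (sleMap κ ω t) z‖ with hD_def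
  set M := 2 * z.im / ε + 1 with hM_def
  have h4 : r * D * M ≤ 2 * (z.im * D) := by
    calc r * D * M ≤ 2 * (sleMap κ ω t z).im * M := by gcongr
      _ = 2 * (M * (sleMap κ ω t z).im) := by ring
      _ ≤ 2 * (z.im * D) := by gcongr
  have h5 : r * M ≤ 2 * z.im := le_of_mul_le_mul_right (by nlinarith [h4]) hD
  have h6 : r < ε := by
    refine lt_of_not_ge fun h7 ↦ ?_
    -- `ε M ≤ r M ≤ 2 Im z`, but `ε M = 2 Im z + ε > 2 Im z`
    have : ε * M ≤ 2 * z.im := (mul_le_mul_of_nonneg_right h7 hMpos.le).trans h5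
    have hεM : ε * M = 2 * z.im + ε := by
      rw [hM_def]; field_simp
    linarith
  linarith [infDist_nonneg (x := z) (s := S)]

section CritPerc

/-- **crit-perc.S20, space-filling phase, from the four core theorems** (Rohde–Schramm, Ann.
Math. 161 (2005), Cor. 7.4 and its Update, p. 911): `ae_isSpaceFilling_sleTrace_of_eight_le`
follows from SLE₈ being a curve (`hasSLETrace_eight`, Lawler–Schramm–Werner (2004), Thm 4.7;
`h8`), the Rohde–Schramm theorem (`hasSLETrace_of_ne_eight`, RS05 Thm 5.1; `hne`), transience
(`tendsto_norm_sleTrace_atTop`, RS05 Thm 7.1 + Update; `htr`) and Lemma 6.3 for `κ ≥ 8`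
(`tendsto_sleDerivRatio_atTop_of_eight_le`; `hZ`); eq. (6.2) and all topology are proved.
[cite: RohdeSchramm2005, Cor. 7.4 and Update (p. 911)] -/
theorem ae_isSpaceFilling_sleTrace_of_eight_le_of_core_facts (h8 : hasSLETrace_eight)
    (hne : hasSLETrace_of_ne_eight) (htr : tendsto_norm_sleTrace_atTop)
    (hZ : tendsto_sleDerivRatio_atTop_of_eight_le) {κ : ℝ≥0} :
    ae_isSpaceFilling_sleTrace_of_eight_le (κ := κ) :=
  ae_isSpaceFilling_sleTrace_of_eight_le_of_facts h8 hne htr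
    (ae_infDist_sleTrace_eq_zero_of_eight_le_of_facts h8 hne hZ)

end CritPerc

end Literature.Probability.RandomPlanarGeometry

end
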